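import Summits.AtomisticToContinuum.Crystallization.Theorems.FrustratedLawDichotomyZoneKernel
import Summits.AtomisticToContinuum.Crystallization.Theorems.FrustratedLawDichotomyAtlasReachTransport

/-!
# FrustratedLawDichotomy · crux `AperiodicFrustratedLawGap` (stmt-AtomisticToContinuum-27623) — «RootedMark»: THE GENERIC ROOTED MARK
# and generic pull-kernel bookkeeping at UNMARKED roots
# (decomp-a2c, (404′) transported line, hand-1 g58, part A of two; INFRASTRUCTURE ONLY — no certificate, no cap, no reach figure)

The cell-free pull kernel (329) `…PullKernel.pullKernel Hm R w` takes an ABSTRACT mark `Hm : Measure E3 → E3 → Prop` with two obligations —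
exact covariance `Hm (θ_y μ) z ↔ Hm μ (z + y)` and JOINT measurability `MeasurableSet {p | Hm p.1 p.2}` — and the tree has ONE family of marks
meeting them, (334′) `…ZoneKernel.HostLikeAt δ τ 𝓐` (coherence of the re-rooted configuration with a countable TEMPLATE atlas), of which
(404′)'s compression mark `Uncompressed r₁` is the one-entry instance.  The K2 object the price sheet of record leaves open (critic r1926 /
r1930: sitewise caps `≥ 0.613` (410)/(411), compression-pull transported caps `≥ 0.24888` (434)) is an income kernel that sees OVER-COORDINATION,
which no template atlas expresses; lens-5 HANDOFF-g118 sized its measurability as «new (334′)-type work».  This file shows it is the (334′) proof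
VERBATIM, for every target at once:

* §1 ★ `RootedMark δ C μ y :⇔ IsRootedHardCore δ (θ_y μ) ∧ θ_y μ ∈ C` for an ARBITRARY target `C ⊆ Measure E3` — «re-rooted at the atom `y`,
  the configuration lies in `C`»: exact covariance for every `μ` (`rootedMark_shift`, from (334′) `map_sub_map_sub`), marked points are atoms,
  the reading at an atom (`rootedMark_iff_of_atom`), Boolean algebra in the target (`RootedMark.mono`, `rootedMark_inter_iff`,
  `not_rootedMark_iff_of_atom`: among atoms the complement of the mark of `C` is the mark of `Cᶜ`), and `hostLikeAt_iff_rootedMark`: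
  (334′)'s mark IS `RootedMark δ (⋃_{(a, W) ∈ 𝓐} coherentOn a τ W)`.
* §2 ★★ `measurableSet_rootedMark`: for `δ > 0` and ANY Giry-measurable `C` the mark is jointly measurable in `(μ, y)` — the (334′) §2 argument
  (ball-condition guard × truncated identity kernel `κ` of `…FiniteClusterGapPrelude`; re-rooting `(μ, y) ↦ θ_y (κ μ)` is jointly measurable)
  with the target `{rooted δ-hard-core} ∩ C` in place of `{rooted} ∩ ⋃ coherentOn`.  So every covariant local statistic of an atom that is a
  measurable set of re-rooted configurations — counts in windows (part B `…CoordPull`), truncated local energies, emptiness of zones — is an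
  admissible mark for (329)/(325) at no further cost (`measurable_pullKernel_rootedMark`).
* §3 generic pull-kernel bookkeeping the tree states only for `compPull` or not at all: ★ `card_mul_le_net_pullKernel` (a marked root EARNS `|T|·a`
  from any finite set `T` of unmarked atoms within `R` on which the weight is `≥ a`; (404′) `card_mul_le_net_compPull` is RECOVERED as the instance
  `card_mul_le_net_compPull_of_generic` — same statement, one-line derivation),
  `inflow_pullKernel_le` / `neg_le_net_pullKernel_of_not_mark` (an unmarked root PAYS at most `M` per marked atom within `R`, for a weight `≤ M`;
  no measurability used: `lintegral_indicator_const_le`), and ★ `net_pullKernel_eq_zero_of_clear` / `floor_add_net_of_floor_clear` /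
  `floor_add_net_of_floor_mark_or_clear`: at an UNMARKED root with NO marked atom within `R` the net flow VANISHES, so every (228) row floor
  transports verbatim there as well — the companion of (329) `floor_add_net_of_floor` (marked roots) for template cells whose whole pull window
  is template-like.
HONEST LABELS.  [folklore: measure theory / bookkeeping] throughout; `RootedMark` is a [new: dial] only in the sense of packaging.  Nothing here is
a certificate or bears on A(η).  Imports: TREE (334′) `…ZoneKernel` (hence (329) `…PullKernel`, `…FiniteClusterGapPrelude`,
`…SignedLedgerHardCoreClass`) and (404′) `…AtlasReachTransport` (`sum_le_lintegral_of_atoms`) only — inside the FrustratedLawDichotomy cone.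
1 plain `def` (`RootedMark`); no instance / notation / option; no `decide`; 0 sorry.
-/

noncomputable section

namespace Summit.AtomisticToContinuum.Crystallization.Theorems.FrustratedLawDichotomyRootedMark

open MeasureTheory Metric Set Filter ProbabilityTheory TopologicalSpace
open scoped ENNReal BigOperators
open Literature.MathematicalPhysics.StatisticalMechanics (rootEnergy)
open Literature.Probability.Process (IsRootedHardCore count_restrict_singleton_ne_zero_iff)
open Literature.Probability.Process.LocalConfig (isClosed_of_separated)
open Summit.AtomisticToContinuum.Crystallization.Theorems.ChargedEnergyGapNegative (E3)
open Summit.AtomisticToContinuum.Crystallization.Theorems.FrustratedLawDichotomySignedLedger (net)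
open Summit.AtomisticToContinuum.Crystallization.Theorems.FrustratedLawDichotomyCoherentOn (coherentOn)
open Summit.AtomisticToContinuum.Crystallization.Theorems.FrustratedLawDichotomyPullKernel
open Summit.AtomisticToContinuum.Crystallization.Theorems.FrustratedLawDichotomyZoneKernel (HostLikeAt map_sub_map_sub map_sub_zero
  map_sub_apply_singleton_zero ballCondition_of_isRootedHardCore_map_sub exists_eq_count_restrict_of_isRootedHardCore_map_sub)
open Summit.AtomisticToContinuum.Crystallization.Theorems.FrustratedLawDichotomyFiniteClusterGap (exists_kernel_eq_count_restrict measurable_kernel_map_sub)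
open Summit.AtomisticToContinuum.Crystallization.Theorems.FrustratedLawDichotomySignedLedgerHardCoreClass
  (measurableSet_setOf_ballCondition ballCondition_iff_exists_count_restrict)
open Summit.AtomisticToContinuum.Crystallization.Theorems.BenjaminiSchrammLimit (measurableSet_setOf_isRootedHardCore)
open Summit.AtomisticToContinuum.Crystallization.Theorems.FrustratedLawDichotomyAtlasReachTransport (sum_le_lintegral_of_atoms Uncompressed
  uncompressed_hshift compPull exists_outflow_bound_compPull)

variable {δ τ : ℝ} {C D : Set (Measure E3)} {𝓐 : Set (Finset E3 × Set E3)} {μ : Measure E3} {y : E3}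

/-! ## §1. The generic rooted mark and its covariance -/

/-- ★ **THE GENERIC ROOTED MARK.**  `RootedMark δ C μ y`: re-rooted at `y`, `μ` is a rooted `δ`-hard-core configuration lying in the target set
`C ⊆ Measure E3`.  Every covariant local property of an atom that is a Giry-measurable set of (re-rooted) configurations is of this form. [new: dial] -/
def RootedMark (δ : ℝ) (C : Set (Measure E3)) (μ : Measure E3) (y : E3) : Prop :=
  IsRootedHardCore δ (μ.map fun x => x - y) ∧ μ.map (fun x => x - y) ∈ C

/-- ★ **EXACT COVARIANCE** of the generic mark (the `hshift` of (329) `…PullKernel`), for every measure `μ`. [folklore] -/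
theorem rootedMark_shift (μ : Measure E3) (y z : E3) : RootedMark δ C (μ.map fun x => x - y) z ↔ RootedMark δ C μ (z + y) := by
  simp only [RootedMark, map_sub_map_sub]

/-- The covariance in the packaged form the (329) lemmas take. [folklore] -/
theorem rootedMark_hshift (δ : ℝ) (C : Set (Measure E3)) :
    ∀ (μ : Measure E3) (y z : E3), RootedMark δ C (μ.map fun x => x - y) z ↔ RootedMark δ C μ (z + y) :=
  rootedMark_shift

/-- The mark at the root: hard core plus membership in the target. [folklore] -/
theorem rootedMark_zero_iff (μ : Measure E3) : RootedMark δ C μ 0 ↔ IsRootedHardCore δ μ ∧ μ ∈ C := by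
  simp only [RootedMark, map_sub_zero]

/-- A marked point is hard-core when viewed from it. -/
theorem RootedMark.isRootedHardCore (h : RootedMark δ C μ y) : IsRootedHardCore δ (μ.map fun x => x - y) := h.1

/-- A marked point's re-rooted configuration lies in the target. -/
theorem RootedMark.mem (h : RootedMark δ C μ y) : μ.map (fun x => x - y) ∈ C := h.2

/-- The target is monotone data: enlarging `C` keeps marks. [folklore] -/
theorem RootedMark.mono (h : RootedMark δ C μ y) (hCD : C ⊆ D) : RootedMark δ D μ y := ⟨h.1, hCD h.2⟩

/-- ★ Marked points are ATOMS. [folklore] -/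
theorem RootedMark.apply_singleton_ne_zero (h : RootedMark δ C μ y) : μ {y} ≠ 0 := by
  obtain ⟨S, h0S, -, hS⟩ := h.1
  rw [← map_sub_apply_singleton_zero, hS]
  exact (count_restrict_singleton_ne_zero_iff S 0).mpr h0S

/-- At an atom of a rooted hard-core configuration the guard is automatic: the mark is membership of the re-rooted configuration. [folklore] -/
theorem rootedMark_iff_of_atom (hμ : IsRootedHardCore δ μ) (hy : μ {y} ≠ 0) : RootedMark δ C μ y ↔ μ.map (fun x => x - y) ∈ C :=
  ⟨fun h => h.2, fun h => ⟨hμ.map_sub hy, h⟩⟩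

/-- Marks intersect: the mark of `C ∩ D` is the conjunction of the marks. [folklore] -/
theorem rootedMark_inter_iff : RootedMark δ (C ∩ D) μ y ↔ RootedMark δ C μ y ∧ RootedMark δ D μ y :=
  ⟨fun h => ⟨⟨h.1, h.2.1⟩, ⟨h.1, h.2.2⟩⟩, fun h => ⟨h.1.1, h.1.2, h.2.2⟩⟩

/-- ★ Among atoms of a rooted hard-core configuration, NOT carrying the mark of `C` is carrying the mark of `Cᶜ` (so «under-coordinated»,
«compressed», … are marks too). [folklore] -/
theorem not_rootedMark_iff_of_atom (hμ : IsRootedHardCore δ μ) (hy : μ {y} ≠ 0) : ¬ RootedMark δ C μ y ↔ RootedMark δ Cᶜ μ y := by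
  rw [rootedMark_iff_of_atom hμ hy, rootedMark_iff_of_atom hμ hy, mem_compl_iff]

/-- ★ (334′)'s HOST-LIKE MARK IS A ROOTED MARK: `HostLikeAt δ τ 𝓐 = RootedMark δ (⋃_{(a, W) ∈ 𝓐} coherentOn a τ W)`. [folklore] -/
theorem hostLikeAt_iff_rootedMark : HostLikeAt δ τ 𝓐 μ y ↔ RootedMark δ (⋃ p ∈ 𝓐, coherentOn p.1 τ p.2) μ y := by
  simp only [HostLikeAt, RootedMark, mem_iUnion, exists_prop]

/-! ## §2. Joint measurability, for any measurable target -/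

/-- The mark as a preimage under a TRUNCATED re-rooting map `(μ, y) ↦ θ_y (κ μ)` (any `κ` fixing the counting measures of `δ`-separated sets),
guarded by the ball condition — the (334′) representation with target `{rooted} ∩ C`. [folklore] -/
theorem setOf_rootedMark_eq (hδ : 0 < δ) (κ : Kernel (Measure E3) E3)
    (hκ : ∀ S : Set E3, (∀ x ∈ S, ∀ y ∈ S, x ≠ y → δ ≤ dist x y) → κ ((Measure.count : Measure E3).restrict S) = (Measure.count : Measure E3).restrict S) :
    {p : Measure E3 × E3 | RootedMark δ C p.1 p.2} =
      Prod.fst ⁻¹' {μ : Measure E3 | ∀ n : ℕ, ∀ q : ℚ, (q : ℝ) < δ / 2 → μ (ball (denseSeq E3 n) q) = 0 ∨ μ (ball (denseSeq E3 n) q) = 1} ∩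
      (fun p : Measure E3 × E3 => (κ p.1).map fun x => x - p.2) ⁻¹' ({ν : Measure E3 | IsRootedHardCore δ ν} ∩ C) := by
  ext ⟨μ, y⟩
  simp only [mem_setOf_eq, mem_inter_iff, mem_preimage, RootedMark]
  constructor
  · rintro ⟨hhc, hC⟩
    have hb := ballCondition_of_isRootedHardCore_map_sub hhc
    obtain ⟨S, hsep, rfl⟩ := exists_eq_count_restrict_of_isRootedHardCore_map_sub hδ hhc
    rw [hκ S hsep]
    exact ⟨hb, hhc, hC⟩
  · rintro ⟨hb, hhc, hC⟩
    obtain ⟨S, hsep, rfl⟩ := (ballCondition_iff_exists_count_restrict hδ _).mp hb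
    rw [hκ S hsep] at hhc hC
    exact ⟨hhc, hC⟩

/-- ★★ **JOINT MEASURABILITY OF EVERY ROOTED MARK** (door clause `hmeas` of (334) / (329) `measurable_pullKernel`): for `δ > 0` and ANY
Giry-measurable target `C`, `{(μ, y) | RootedMark δ C μ y}` is measurable in `Measure E3 × E3`. [folklore] -/
theorem measurableSet_rootedMark (hδ : 0 < δ) (hC : MeasurableSet C) : MeasurableSet {p : Measure E3 × E3 | RootedMark δ C p.1 p.2} := by
  obtain ⟨κ, hκs, hκ⟩ := exists_kernel_eq_count_restrict hδ
  rw [setOf_rootedMark_eq hδ κ hκ]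
  exact (measurable_fst (measurableSet_setOf_ballCondition δ)).inter
    ((measurable_kernel_map_sub κ) ((measurableSet_setOf_isRootedHardCore hδ).inter hC))

/-- The `μ`-section of a rooted mark is a measurable set of points. [folklore] -/
theorem measurableSet_rootedMark_section (hδ : 0 < δ) (hC : MeasurableSet C) (μ : Measure E3) : MeasurableSet {y : E3 | RootedMark δ C μ y} :=
  measurable_prodMk_left (measurableSet_rootedMark hδ hC)

/-- Door clause `hG` of (325) for the pull kernel of ANY rooted mark with a measurable weight. [folklore] -/
theorem measurable_pullKernel_rootedMark (hδ : 0 < δ) (hC : MeasurableSet C) (R : ℝ) {w : E3 → ℝ≥0∞} (hw : Measurable w) :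
    Measurable (Function.uncurry (pullKernel (RootedMark δ C) R w)) :=
  measurable_pullKernel (measurableSet_rootedMark hδ hC) hw

/-! ## §3. Generic pull-kernel bookkeeping: what a marked root earns, what an unmarked root pays -/

variable {Hm : Measure E3 → E3 → Prop} {R : ℝ} {w : E3 → ℝ≥0∞}

/-- ★ **A MARKED ROOT EARNS FROM EVERY FINITE SET OF UNMARKED ATOMS WITHIN `R`**: if the weight is `≥ a ≥ 0` on `T` and the out-flow is finite,
`|T|·a ≤ net 0 (pullKernel Hm R w) μ`.  ((404′) `card_mul_le_net_compPull` is the instance `Hm = Uncompressed r₁`, `w ≡ a`.) [folklore] -/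
theorem card_mul_le_net_pullKernel (hshift : ∀ (μ : Measure E3) (y z : E3), Hm (μ.map fun x => x - y) z ↔ Hm μ (z + y))
    (hμ : IsRootedHardCore δ μ) (h0 : Hm μ 0) {a : ℝ} (ha : 0 ≤ a) (hfin : ∫⁻ y, pullKernel Hm R w μ y ∂μ ≠ ∞) (T : Finset E3)
    (hT : ∀ y ∈ T, μ {y} ≠ 0 ∧ ‖y‖ ≤ R ∧ ¬ Hm μ y) (hw : ∀ y ∈ T, ENNReal.ofReal a ≤ w y) :
    (T.card : ℝ) * a ≤ net 0 (pullKernel Hm R w) μ := by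
  have hsum : (T.card : ℝ≥0∞) * ENNReal.ofReal a ≤ ∑ y ∈ T, pullKernel Hm R w μ y :=
    calc (T.card : ℝ≥0∞) * ENNReal.ofReal a = ∑ _y ∈ T, ENNReal.ofReal a := by rw [Finset.sum_const, nsmul_eq_mul]
      _ ≤ ∑ y ∈ T, pullKernel Hm R w μ y :=
          Finset.sum_le_sum fun y hy => by rw [pullKernel_of_mem h0 (hT y hy).2.1 (hT y hy).2.2]; exact hw y hy
  have hle : (T.card : ℝ≥0∞) * ENNReal.ofReal a ≤ ∫⁻ y, pullKernel Hm R w μ y ∂μ :=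
    hsum.trans (sum_le_lintegral_of_atoms hμ T (fun y hy => (hT y hy).1) _)
  have h := ENNReal.toReal_mono hfin hle
  rw [ENNReal.toReal_mul, ENNReal.toReal_natCast, ENNReal.toReal_ofReal ha] at h
  rwa [net_zero_pullKernel_of_mark hshift h0]

/-- (404′) `card_mul_le_net_compPull` RECOVERED from the generic lemma in one line: the compression pull is the instance `Hm = Uncompressed r₁`,
`w ≡ a` (finite out-flow from (404′) `exists_outflow_bound_compPull`). [folklore] -/
theorem card_mul_le_net_compPull_of_generic {r₁ R a : ℝ} (ha : 0 ≤ a) (hμ : IsRootedHardCore (7 / 10) μ) (h0 : Uncompressed r₁ μ 0)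
    (T : Finset E3) (hT : ∀ y ∈ T, μ {y} ≠ 0 ∧ ‖y‖ ≤ R ∧ ¬ Uncompressed r₁ μ y) : (T.card : ℝ) * a ≤ net 0 (compPull r₁ R a) μ := by
  obtain ⟨B, hB, hBb⟩ := exists_outflow_bound_compPull r₁ R a
  exact card_mul_le_net_pullKernel (uncompressed_hshift r₁) hμ h0 ha (ne_top_of_le_ne_top hB (hBb μ hμ)) T hT fun _ _ => le_rfl

/-- What an unmarked root pays to the marked atom `y` (the in-flow integrand), read through the covariance: it is `w (−y)` iff `y` is marked,
`‖y‖ ≤ R`, and the root is unmarked; in particular it is dominated by `M · 1[‖y‖ ≤ R ∧ Hm μ y]` for a weight `≤ M`. [folklore] -/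
theorem pullKernel_reroot_le (hshift : ∀ (μ : Measure E3) (y z : E3), Hm (μ.map fun x => x - y) z ↔ Hm μ (z + y)) {M : ℝ≥0∞}
    (hwM : ∀ z, w z ≤ M) (μ : Measure E3) (y : E3) :
    pullKernel Hm R w (μ.map fun x => x - y) (-y) ≤ {z : E3 | ‖z‖ ≤ R ∧ Hm μ z}.indicator (fun _ => M) y := by
  by_cases hy : ‖y‖ ≤ R ∧ Hm μ y
  · rw [indicator_of_mem (show y ∈ {z : E3 | ‖z‖ ≤ R ∧ Hm μ z} from hy)]
    exact (pullKernel_le _ _).trans (hwM _)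
  · refine le_of_eq_of_le ?_ bot_le
    rw [not_and_or] at hy
    rcases hy with hR | hm
    · exact pullKernel_eq_zero_of_lt_norm (by rw [norm_neg]; exact not_le.mp hR)
    · exact pullKernel_eq_zero_of_not_mark_root (fun h => hm (by have := (hshift μ y 0).mp h; rwa [zero_add] at this)) _

/-- ★ **WHAT AN UNMARKED ROOT PAYS IS AT MOST `M` PER MARKED ATOM WITHIN `R`**: `in-flow ≤ M · μ {z | ‖z‖ ≤ R ∧ Hm μ z}` (no measurability of the
mark is needed: `lintegral_indicator_const_le`). [folklore] -/
theorem inflow_pullKernel_le (hshift : ∀ (μ : Measure E3) (y z : E3), Hm (μ.map fun x => x - y) z ↔ Hm μ (z + y)) {M : ℝ≥0∞}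
    (hwM : ∀ z, w z ≤ M) (μ : Measure E3) :
    ∫⁻ y, pullKernel Hm R w (μ.map fun x => x - y) (-y) ∂μ ≤ M * μ {z : E3 | ‖z‖ ≤ R ∧ Hm μ z} :=
  (lintegral_mono fun y => pullKernel_reroot_le hshift hwM μ y).trans (lintegral_indicator_const_le _ _)

/-- Hence the net flow at an unmarked root is `≥ −(M · μ{marked atoms within R}).toReal`. [folklore] -/
theorem neg_le_net_pullKernel_of_not_mark (hshift : ∀ (μ : Measure E3) (y z : E3), Hm (μ.map fun x => x - y) z ↔ Hm μ (z + y)) {M : ℝ≥0∞}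
    (hwM : ∀ z, w z ≤ M) (h0 : ¬ Hm μ 0) (hfin : M * μ {z : E3 | ‖z‖ ≤ R ∧ Hm μ z} ≠ ∞) :
    -(M * μ {z : E3 | ‖z‖ ≤ R ∧ Hm μ z}).toReal ≤ net 0 (pullKernel Hm R w) μ := by
  rw [net_zero_pullKernel_of_not_mark h0, neg_le_neg_iff]
  exact ENNReal.toReal_mono hfin (inflow_pullKernel_le hshift hwM μ)

/-- ★ **A CLEAR WINDOW PAYS NOBODY**: at a rooted `δ`-hard-core configuration (`δ > 0`) with NO marked atom within `R` of the root, the in-flow of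
the pull kernel vanishes. [folklore] -/
theorem inflow_pullKernel_eq_zero_of_clear (hδ : 0 < δ) (hshift : ∀ (μ : Measure E3) (y z : E3), Hm (μ.map fun x => x - y) z ↔ Hm μ (z + y))
    (hμ : IsRootedHardCore δ μ) (hclear : ∀ z : E3, μ {z} ≠ 0 → ‖z‖ ≤ R → ¬ Hm μ z) :
    ∫⁻ y, pullKernel Hm R w (μ.map fun x => x - y) (-y) ∂μ = 0 := by
  have hle : ∫⁻ y, pullKernel Hm R w (μ.map fun x => x - y) (-y) ∂μ ≤ ⊤ * μ {z : E3 | ‖z‖ ≤ R ∧ Hm μ z} :=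
    inflow_pullKernel_le hshift (fun _ => le_top) μ
  have h0 : μ {z : E3 | ‖z‖ ≤ R ∧ Hm μ z} = 0 := by
    obtain ⟨S, -, hsep, rfl⟩ := hμ
    rw [Measure.restrict_apply' (isClosed_of_separated hδ hsep).measurableSet, Measure.count_eq_zero_iff]
    refine Set.eq_empty_of_forall_notMem fun z hz => ?_
    exact hclear z ((count_restrict_singleton_ne_zero_iff S z).mpr hz.2) hz.1.1 hz.1.2
  rw [h0, mul_zero] at hle
  exact le_antisymm hle bot_le

/-- ★ **AT AN UNMARKED ROOT WITH A CLEAR WINDOW THE NET FLOW VANISHES.** [folklore] -/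
theorem net_pullKernel_eq_zero_of_clear (hδ : 0 < δ) (hshift : ∀ (μ : Measure E3) (y z : E3), Hm (μ.map fun x => x - y) z ↔ Hm μ (z + y))
    (hμ : IsRootedHardCore δ μ) (h0 : ¬ Hm μ 0) (hclear : ∀ z : E3, μ {z} ≠ 0 → ‖z‖ ≤ R → ¬ Hm μ z) :
    net 0 (pullKernel Hm R w) μ = 0 := by
  rw [net_zero_pullKernel_of_not_mark h0, inflow_pullKernel_eq_zero_of_clear hδ hshift hμ hclear, ENNReal.toReal_zero, neg_zero]

/-- ★ **ROW FLOORS TRANSPORT VERBATIM AT UNMARKED ROOTS WITH A CLEAR WINDOW** (companion of (329) `floor_add_net_of_floor`, which is the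
marked-root case): `c + m ≤ rootEnergy V μ` gives `c + m ≤ rootEnergy V μ + net 0 (pullKernel Hm R w) μ`. [folklore] -/
theorem floor_add_net_of_floor_clear (hδ : 0 < δ) (hshift : ∀ (μ : Measure E3) (y z : E3), Hm (μ.map fun x => x - y) z ↔ Hm μ (z + y))
    (hμ : IsRootedHardCore δ μ) (h0 : ¬ Hm μ 0) (hclear : ∀ z : E3, μ {z} ≠ 0 → ‖z‖ ≤ R → ¬ Hm μ z) {V : ℝ → ℝ} {c m : ℝ}
    (h : c + m ≤ rootEnergy V μ) : c + m ≤ rootEnergy V μ + net 0 (pullKernel Hm R w) μ := by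
  rw [net_pullKernel_eq_zero_of_clear hδ hshift hμ h0 hclear, add_zero]; exact h

/-- The two verbatim cases together: a row floor transports at every root that is EITHER marked OR has a clear window. [folklore] -/
theorem floor_add_net_of_floor_mark_or_clear (hδ : 0 < δ) (hshift : ∀ (μ : Measure E3) (y z : E3), Hm (μ.map fun x => x - y) z ↔ Hm μ (z + y))
    (hμ : IsRootedHardCore δ μ) (h0 : Hm μ 0 ∨ ∀ z : E3, μ {z} ≠ 0 → ‖z‖ ≤ R → ¬ Hm μ z) {V : ℝ → ℝ} {c m : ℝ}
    (h : c + m ≤ rootEnergy V μ) : c + m ≤ rootEnergy V μ + net 0 (pullKernel Hm R w) μ := by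
  by_cases hm : Hm μ 0
  · exact floor_add_net_of_floor hshift hm h
  · rcases h0 with h0 | h0
    · exact absurd h0 hm
    · exact floor_add_net_of_floor_clear hδ hshift hμ hm h0 h

end Summit.AtomisticToContinuum.Crystallization.Theorems.FrustratedLawDichotomyRootedMark

end
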